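import Summits.QuantumFields.BalabanUV.Beta.D1BFx.GhostLegMasses

/-!
# `BalabanUV.Beta.D1BFx.ProjectorMasses` — road «BF-x» for binder row D1, slot (K), (II)-rows (C1)(C2), FILE γ2 «LEG-MASS ∕ PROJECTOR»: **THE PROJECTOR
# `Pgt = n⁻⁴·(G′Q′*)∘C∘(G′Q′*)ᵀ` AS A COMPOSITION OF `ℤ⁴`-KERNELS ON THE BLOCK SUBLATTICE `nℤ⁴`, AND ITS n-FREE θ-WEIGHTED MASSES**
# `e^{8nθ}·g²·c_C·Zl 4 (δ_C∕4 − nθ)` (`n⁻⁴·(e^{4nθ}g)·(c_C Zl)·(n⁴e^{4nθ}g)`); `Rgt = idK − Pgt` ⟹ `1 + π`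

HONEST DEPENDENCY (cell records, verbatim): «continuum YM on T⁴ ⇐ BetaPertH ∧ nine spine estimates (0/9 proved); BetaPertH ⇐ (D1) ∧ (D4) ∧
CAP+tail; G-an2-4 gates asym, D1 and NE2/3/4.»  HONEST FRAMING (cell contract, verbatim): «discharging `BetaPertH` makes Bałaban's UV stability
UNCONDITIONAL — a real constructive-QFT result; it is NOT the continuum limit and NOT the Clay problem.»  THIS MODULE DISCHARGES NOTHING of the
wall: two [our object] RE-INDEXING definitions (`gqK`, `csqK`: the road's `gq = G′Q′*` and `Csq = (Q′G′²Q′*)⁻¹` placed on the sublattice `nℤ⁴`, zero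
elsewhere — they assert nothing) + [folklore] bookkeeping BY NAME over `RProjector` (`Pker ∕ kerP ∕ Pgt_apply ∕ Pgt_symm ∕ Csq_symm`), `B5Hk103ScalarZd`
(`gq`, `tsum_blocks`), `B6QGGQ278Zd.abs_Csq_le`, `GhostLeg`, FILE α1.  No `def … : Prop`, nothing cited, 0 sorry.  0 root-level binders of row D1 discharged (hW ∕ hR-sockets ∕ hSX-socket ∕ D1Tel ∕ D1Rep = 0); (K) NOT closed; (C1)(C2) NOT closed here (these are their LEG letters); NOT D1, NOT `BetaPertH`, NOT continuum, NOT Clay.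

ABSOLUTE RULE (cell charter, verbatim): «No internally-minted statement may enter as a cited fact. Every hypothesis is either kernel-proved in
this package or a verbatim quotation of a PUBLISHED theorem with page reference. The manuscript(s) under audit are NOT citable for their own
disputed steps — they are the thing under adjudication; programme-internal (2001/route/tribunal) claims are never citable.»

WHY.  The road's pointwise letter `RProjector.abs_Pgt_le` has `cPP = O(1)` (true size `n⁻⁴`), so its row mass through `Zl` is `n⁴`; the TRUE `n⁰`
needs the factorisation `Pker = n⁻⁴ Σ_w kerP(·,w) gq(·,w)` with the θ-weights following the GEOMETRY — hence the sublattice embedding `w ↦ n•w`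
(then `|x − n•w|₁` is the distance the weights see) and α1's `rowMass_comp` twice.

CONTENT (`n ≥ 1`, `a > 0`; `θ ≥ 0`, `nθ < δ_C∕4` where stated).
* §1 [our objects] `gqK n a`, `csqK n a`; `smul_facts`, `eq_smul_of_dvd`, `tsum_sublattice`, `summable_sublattice_iff`.
* §2 `comp_gqK_csqK` (`= kerP` on the sublattice), **`Pgt_eq_comp : Pgt n a = (n⁴)⁻¹ • comp (comp (gqK n a) (csqK n a)) (trK (gqK n a))`**.
* §3 `l1_sub_smul_blk_le`, **`rowMass_gqK`** (`e^{4nθ}·g`, `tsum_blocks`), **`colMass_gqK`** (`n⁴·e^{4nθ}·g`), **`masses_csqK`** (`c_C·Zl 4 (δ_C∕4 − nθ)`).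
* §4 **`masses_Pgt`**, `Rgt_eq_idK_sub`, **`masses_Rgt`** (`1 + π`).
NOT HERE: `Cgh`, `lapU∘Cgh`, the master letter (γ3); gradient masses (γ′, for (C1)).
Unit `b2b-balaban-gan24-formalise-leaf-05` (gen 54), G-an2-4 swarm leaf prover 05, road «BF-x» (C1)(C2) count owner (RULING ρ-g19-1 AMENDED, journal l.43347); INTENT «LEG-MASS» (journal).
-/


noncomputable section

namespace Summit.QuantumFields.BalabanUV.Beta.D1BFx.ProjectorMasses

open scoped BigOperators
open Finset
open Literature.MathematicalPhysics.QuantumFieldTheory.Balaban1983to89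
open Literature.MathematicalPhysics.QuantumFieldTheory.Balaban1983to89.Beta
open B12Sec2to5 (l1 l1_nonneg)
open ExpKernelCalculus (Site MKer comp Zl Zl_pos l1_sub_triangle l1_sub_symm l1_natSmul summable_exp_shift tsum_exp_shift)
open HessKerSchurResolvent (idK idK_apply)
open B6QGQLower276 (X e blk B mem_B sameBlk AX dist_le_of_blk_eq)
open B5Hk103ScalarZd (Gk gq tsum_blocks summable_blocks)
open B6QGGQ278Zd (Csq abs_Csq_le cC deltaC deltaC_pos cC_pos)
open Summit.QuantumFields.BalabanUV.Beta.TameKernelCalculus (trK trK_comp trK_trK)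
open Summit.QuantumFields.BalabanUV.Beta.D1BFx.GhostLeg (Ggh Ggh_apply Ggh_symm trK_Ggh blk_pred_apply l1_sub_le_four_mul_dist)
open Summit.QuantumFields.BalabanUV.Beta.D1BFx.RProjector (Pgt Pgt_apply Pgt_symm kerP Pker summable_kerP summable_Pker Csq_symm)
open Summit.QuantumFields.BalabanUV.Beta.D1BFx.RJetProjector (Rgt Rgt_apply)
open Summit.QuantumFields.BalabanUV.Beta.D1BFx.KernelMassCalculus
open Summit.QuantumFields.BalabanUV.Beta.D1BFx.GhostLegMasses (rowFn_unit masses_idK)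

variable (n : ℕ) [NeZero n] (a : ℝ)

/-! ## §1 The two factors of `Pgt` as kernels on the block sublattice `nℤ⁴ ⊂ ℤ⁴` -/

/-- [our object] **`G′Q′*` ON THE SUBLATTICE**: `gqK n a x u := (G′Q′*)(x, u∕n)` if `u ∈ nℤ⁴`, else `0` — the fine-site × block-label matrix `gq` re-indexed so that
the block `w` sits at its geometric position `n•w` (then `|x − u|₁` IS the distance the θ-weights see). A definition; asserts nothing. -/
def gqK : MKer 4 Unit := fun x u _ _ =>
  if (∀ i, (n : ℤ) ∣ u i) then gq (d := 4) (n - 1) a x (fun i => u i / n) else 0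

/-- [our object] **«THE OPERATOR C» ON THE SUBLATTICE**: `csqK n a u u′ := C(u∕n, u′∕n)` for `u, u′ ∈ nℤ⁴`, else `0` (`C = (Q′G′²Q′*)⁻¹ = B6QGGQ278Zd.Csq`).
A definition; asserts nothing. -/
def csqK : MKer 4 Unit := fun u u' _ _ =>
  if (∀ i, (n : ℤ) ∣ u i) ∧ (∀ i, (n : ℤ) ∣ u' i) then Csq (d := 4) (n - 1) a (fun i => u i / n) (fun i => u' i / n) else 0

variable {n a}

/-- [folklore] The sublattice embedding `w ↦ n•w` is injective and lands in `nℤ⁴`, with `(n•w) i ∕ n = w i`. -/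
theorem smul_facts : Function.Injective (fun w : Site 4 => (n : ℤ) • w) ∧
    (∀ w : Site 4, ∀ i, (n : ℤ) ∣ ((n : ℤ) • w) i) ∧ (∀ w : Site 4, (fun i => (n : ℤ) * w i / (n : ℤ)) = w) := by
  have hn : (n : ℤ) ≠ 0 := by exact_mod_cast NeZero.ne n
  refine ⟨fun w w' h => ?_, fun w i => ?_, fun w => funext fun i => Int.mul_ediv_cancel_left _ hn⟩
  · funext i
    have := congrFun h i
    simp only [Pi.smul_apply, smul_eq_mul] at this
    exact mul_left_cancel₀ hn this
  · simp only [Pi.smul_apply, smul_eq_mul]; exact dvd_mul_right _ _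

omit [NeZero n] in
/-- [folklore] A point of `nℤ⁴` is `n•(u∕n)`. -/
theorem eq_smul_of_dvd {u : Site 4} (hu : ∀ i, (n : ℤ) ∣ u i) : u = (n : ℤ) • (fun i => u i / (n : ℤ)) := by
  funext i; simp only [Pi.smul_apply, smul_eq_mul]; exact (Int.mul_ediv_cancel' (hu i)).symm

/-- [folklore] Summing a function supported on `nℤ⁴` over `ℤ⁴` = summing over the block labels. -/
theorem tsum_sublattice {f : Site 4 → ℝ} (hf : ∀ u, ¬ (∀ i, (n : ℤ) ∣ u i) → f u = 0) :
    ∑' u, f u = ∑' w : Site 4, f ((n : ℤ) • w) := by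
  obtain ⟨hinj, hdvd, hdiv⟩ := smul_facts (n := n)
  refine (hinj.tsum_eq fun u hu => ?_).symm
  by_contra hrange
  exact hu (hf u fun hall => hrange ⟨fun i => u i / (n : ℤ), (eq_smul_of_dvd (n := n) hall).symm⟩)

/-- [folklore] The same for summability. -/
theorem summable_sublattice_iff {f : Site 4 → ℝ} (hf : ∀ u, ¬ (∀ i, (n : ℤ) ∣ u i) → f u = 0) :
    Summable f ↔ Summable fun w : Site 4 => f ((n : ℤ) • w) := by
  obtain ⟨hinj, hdvd, hdiv⟩ := smul_facts (n := n)
  refine (hinj.summable_iff fun u hu => ?_).symm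
  exact hf u fun hall => hu ⟨fun i => u i / (n : ℤ), (eq_smul_of_dvd (n := n) hall).symm⟩

/-! ## §2 `Pgt` IS the sublattice composition -/

/-- [folklore] The inner composition: `(gqK ∘ csqK)(x, u′) = kerP (x, u′∕n)` on `nℤ⁴`, `0` off it. -/
theorem comp_gqK_csqK (_ha : 0 < a) (x u' : Site 4) (u v : Unit) :
    comp (gqK n a) (csqK n a) x u' u v = if (∀ i, (n : ℤ) ∣ u' i) then kerP (d := 4) (n - 1) a x (fun i => u' i / n) else 0 := by
  obtain ⟨hinj, hdvd, hdiv⟩ := smul_facts (n := n)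
  unfold ExpKernelCalculus.comp
  simp only [Finset.univ_unique, Finset.sum_singleton]
  by_cases hu' : ∀ i, (n : ℤ) ∣ u' i
  · rw [if_pos hu']
    have hzero : ∀ w, ¬ (∀ i, (n : ℤ) ∣ w i) → gqK n a x w u default * csqK n a w u' default v = 0 := fun w hw => by
      simp [gqK, hw]
    rw [tsum_sublattice hzero, kerP]
    refine tsum_congr fun w => ?_
    simp [gqK, csqK, hu', hdiv]
  · rw [if_neg hu']
    have : ∀ w, gqK n a x w u default * csqK n a w u' default v = 0 := fun w => by simp [csqK, hu']
    simp [this]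

/-- [folklore] **`Pgt` AS A COMPOSITION OF `ℤ⁴`-KERNELS**: `Pgt n a = (n⁴)⁻¹ • (gqK ∘ csqK ∘ (gqK)ᵀ)` — `RProjector.Pker` unfolded, the two series over
block labels re-indexed onto the sublattice. -/
theorem Pgt_eq_comp (ha : 0 < a) : Pgt n a = ((n : ℝ) ^ 4)⁻¹ • comp (comp (gqK n a) (csqK n a)) (trK (gqK n a)) := by
  obtain ⟨hinj, hdvd, hdiv⟩ := smul_facts (n := n)
  funext x y u v
  simp only [Pi.smul_apply, smul_eq_mul]
  rw [Pgt_apply, Pker, GhostLeg.cast_pred_add_one n]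
  congr 1
  unfold ExpKernelCalculus.comp
  simp only [Finset.univ_unique, Finset.sum_singleton]
  have hzero : ∀ w, ¬ (∀ i, (n : ℤ) ∣ w i) →
      (∑' z, gqK n a x z u default * csqK n a z w default default) * trK (gqK n a) w y default v = 0 := fun w hw => by
    simp [trK, gqK, hw]
  rw [tsum_sublattice hzero]
  refine tsum_congr fun w => ?_
  have h1 := comp_gqK_csqK (n := n) (a := a) ha x ((n : ℤ) • w) u default
  unfold ExpKernelCalculus.comp at h1
  simp only [Finset.univ_unique, Finset.sum_singleton] at h1
  rw [h1, if_pos (hdvd w)]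
  simp [trK, gqK, hdiv]

/-! ## §3 The masses of the two factors -/

/-- [folklore] A site of the block `w` (side `n`) is `ℓ¹`-close to `n•w`: `|q − n•w|₁ ≤ 4n`. -/
theorem l1_sub_smul_blk_le {q w : Site 4} (hq : blk (n - 1) q = w) : l1 (q - (n : ℤ) • w) ≤ 4 * (n : ℝ) := by
  have hn : (0 : ℤ) < n := by exact_mod_cast Nat.pos_of_ne_zero (NeZero.ne n)
  have hcoord : ∀ i, |((q - (n : ℤ) • w) i : ℝ)| ≤ (n : ℝ) := fun i => by
    have hw : w i = q i / (n : ℤ) := by rw [← hq, blk_pred_apply]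
    simp only [Pi.sub_apply, Pi.smul_apply, smul_eq_mul, hw]
    have h1 : q i - (n : ℤ) * (q i / (n : ℤ)) = q i % (n : ℤ) := by rw [Int.emod_def]
    rw [h1]
    have h2 : 0 ≤ q i % (n : ℤ) := Int.emod_nonneg _ hn.ne'
    have h3 : q i % (n : ℤ) < n := Int.emod_lt_of_pos _ hn
    rw [abs_of_nonneg (by exact_mod_cast h2)]
    exact_mod_cast h3.le
  calc l1 (q - (n : ℤ) • w) = ∑ i : Fin 4, |((q - (n : ℤ) • w) i : ℝ)| := rfl
    _ ≤ ∑ _i : Fin 4, (n : ℝ) := Finset.sum_le_sum fun i _ => hcoord i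
    _ = 4 * (n : ℝ) := by simp [Finset.sum_const, mul_comm]

variable {θ : ℝ}

/-- [folklore] **ROW MASS OF `gqK`**: `RowMass (Ggh n a) θ g → RowMass (gqK n a) θ (e^{4nθ}·g)` (`θ ≥ 0`; block by block, `tsum_blocks`). -/
theorem rowMass_gqK (hθ : 0 ≤ θ) {g : ℝ} (hG : RowMass (Ggh n a) θ g) : RowMass (gqK n a) θ (Real.exp (4 * n * θ) * g) := by
  obtain ⟨hinj, hdvd, hdiv⟩ := smul_facts (n := n)
  intro x
  have hzero : ∀ u', ¬ (∀ i, (n : ℤ) ∣ u' i) → rowFn (gqK n a) θ x u' = 0 := fun u' hu' => by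
    rw [rowFn_unit]; simp [gqK, hu']
  -- the block-by-block majorant
  have hG' := hG x
  have erow : ∀ q, rowFn (Ggh n a) θ x q = |Gk (d := 4) (n - 1) a x q| * Real.exp (θ * l1 (x - q)) := fun q => by
    rw [rowFn_unit, Ggh_apply]
  have hsumG : Summable fun q => |Gk (d := 4) (n - 1) a x q| * Real.exp (θ * l1 (x - q)) := hG'.1.congr erow
  have hblk : ∀ w, rowFn (gqK n a) θ x ((n : ℤ) • w)
      ≤ Real.exp (4 * n * θ) * ∑ q ∈ B (n - 1) w, |Gk (d := 4) (n - 1) a x q| * Real.exp (θ * l1 (x - q)) := by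
    intro w
    rw [rowFn_unit]
    simp only [gqK, Pi.smul_apply, smul_eq_mul, hdiv, dvd_mul_right, forall_const, if_true]
    rw [gq]
    refine (mul_le_mul_of_nonneg_right (Finset.abs_sum_le_sum_abs (fun q => Gk (d := 4) (n - 1) a x q) (B (n - 1) w))
      (Real.exp_pos _).le).trans ?_
    rw [Finset.mul_sum, Finset.sum_mul]
    refine Finset.sum_le_sum fun q hq => ?_
    have hl : l1 (x - (n : ℤ) • w) ≤ l1 (x - q) + 4 * n := by
      have := l1_sub_triangle x q ((n : ℤ) • w)
      have := l1_sub_smul_blk_le (mem_B.1 hq)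
      linarith
    calc |Gk (d := 4) (n - 1) a x q| * Real.exp (θ * l1 (x - (n : ℤ) • w))
        ≤ |Gk (d := 4) (n - 1) a x q| * Real.exp (θ * (l1 (x - q) + 4 * n)) :=
          mul_le_mul_of_nonneg_left (Real.exp_le_exp.2 (mul_le_mul_of_nonneg_left hl hθ)) (abs_nonneg _)
      _ = Real.exp (4 * n * θ) * (|Gk (d := 4) (n - 1) a x q| * Real.exp (θ * l1 (x - q))) := by
          rw [mul_add, Real.exp_add]; ring
  have hsB : Summable fun w => Real.exp (4 * n * θ) * ∑ q ∈ B (n - 1) w, |Gk (d := 4) (n - 1) a x q| * Real.exp (θ * l1 (x - q)) :=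
    (summable_blocks (n - 1) hsumG).mul_left _
  have hsub : Summable fun w => rowFn (gqK n a) θ x ((n : ℤ) • w) := hsB.of_nonneg_of_le (fun w => rowFn_nonneg _ _ _ _) hblk
  refine ⟨(summable_sublattice_iff hzero).2 hsub, ?_⟩
  rw [tsum_sublattice hzero]
  calc ∑' w, rowFn (gqK n a) θ x ((n : ℤ) • w)
      ≤ ∑' w, Real.exp (4 * n * θ) * ∑ q ∈ B (n - 1) w, |Gk (d := 4) (n - 1) a x q| * Real.exp (θ * l1 (x - q)) := hsub.tsum_le_tsum hblk hsB
    _ = Real.exp (4 * n * θ) * ∑' q, |Gk (d := 4) (n - 1) a x q| * Real.exp (θ * l1 (x - q)) := by rw [tsum_mul_left, tsum_blocks _ hsumG]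
    _ ≤ Real.exp (4 * n * θ) * g := by
        refine mul_le_mul_of_nonneg_left ?_ (Real.exp_pos _).le
        have := hG'.2; simp_rw [erow] at this; exact this

/-- [folklore] **COLUMN MASS OF `gqK`**: `ColMass (Ggh n a) θ g → ColMass (gqK n a) θ (n⁴·e^{4nθ}·g)` (`θ ≥ 0`; one column = a block of `n⁴` columns of `Ggh`). -/
theorem colMass_gqK (hθ : 0 ≤ θ) {g : ℝ} (hG : ColMass (Ggh n a) θ g) : ColMass (gqK n a) θ ((n : ℝ) ^ 4 * Real.exp (4 * n * θ) * g) := by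
  obtain ⟨hinj, hdvd, hdiv⟩ := smul_facts (n := n)
  have hg0 : 0 ≤ g := hG.nonneg
  intro u'
  by_cases hu' : ∀ i, (n : ℤ) ∣ u' i
  · set w : Site 4 := fun i => u' i / (n : ℤ) with hw
    have hu'eq : u' = (n : ℤ) • w := eq_smul_of_dvd hu'
    have ecol : ∀ x, rowFn (gqK n a) θ x u' = |∑ q ∈ B (n - 1) w, Gk (d := 4) (n - 1) a x q| * Real.exp (θ * l1 (x - u')) := fun x => by
      rw [rowFn_unit]; simp only [gqK, hu']; rfl
    have hle : ∀ x, rowFn (gqK n a) θ x u' ≤ Real.exp (4 * n * θ) * ∑ q ∈ B (n - 1) w, rowFn (Ggh n a) θ x q := by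
      intro x
      rw [ecol]
      refine (mul_le_mul_of_nonneg_right (Finset.abs_sum_le_sum_abs (fun q => Gk (d := 4) (n - 1) a x q) (B (n - 1) w))
        (Real.exp_pos _).le).trans ?_
      rw [Finset.mul_sum, Finset.sum_mul]
      refine Finset.sum_le_sum fun q hq => ?_
      rw [rowFn_unit, Ggh_apply]
      have hl : l1 (x - u') ≤ l1 (x - q) + 4 * n := by
        have := l1_sub_triangle x q u'
        have h2 := l1_sub_smul_blk_le (n := n) (mem_B.1 hq)
        rw [← hu'eq] at h2
        linarith
      calc |Gk (d := 4) (n - 1) a x q| * Real.exp (θ * l1 (x - u'))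
          ≤ |Gk (d := 4) (n - 1) a x q| * Real.exp (θ * (l1 (x - q) + 4 * n)) :=
            mul_le_mul_of_nonneg_left (Real.exp_le_exp.2 (mul_le_mul_of_nonneg_left hl hθ)) (abs_nonneg _)
        _ = Real.exp (4 * n * θ) * (|Gk (d := 4) (n - 1) a x q| * Real.exp (θ * l1 (x - q))) := by
            rw [mul_add, Real.exp_add]; ring
    have hsB : Summable fun x => Real.exp (4 * n * θ) * ∑ q ∈ B (n - 1) w, rowFn (Ggh n a) θ x q :=
      (summable_sum fun q _ => (hG q).1).mul_left _
    have hs : Summable fun x => rowFn (gqK n a) θ x u' := hsB.of_nonneg_of_le (fun x => rowFn_nonneg _ _ _ _) hle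
    refine ⟨hs, (hs.tsum_le_tsum hle hsB).trans ?_⟩
    rw [tsum_mul_left, Summable.tsum_finsetSum (fun q _ => (hG q).1)]
    have hB : ∑ q ∈ B (n - 1) w, ∑' x, rowFn (Ggh n a) θ x q ≤ (n : ℝ) ^ 4 * g :=
      calc ∑ q ∈ B (n - 1) w, ∑' x, rowFn (Ggh n a) θ x q ≤ ∑ _q ∈ B (n - 1) w, g := Finset.sum_le_sum fun q _ => (hG q).2
        _ = (n : ℝ) ^ 4 * g := by rw [B6QGQLower276.sum_B_const, GhostLeg.cast_pred_add_one n]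
    calc Real.exp (4 * n * θ) * ∑ q ∈ B (n - 1) w, ∑' x, rowFn (Ggh n a) θ x q ≤ Real.exp (4 * n * θ) * ((n : ℝ) ^ 4 * g) :=
          mul_le_mul_of_nonneg_left hB (Real.exp_pos _).le
      _ = (n : ℝ) ^ 4 * Real.exp (4 * n * θ) * g := by ring
  · have hz : ∀ x, rowFn (gqK n a) θ x u' = 0 := fun x => by rw [rowFn_unit]; simp [gqK, hu']
    refine ⟨(summable_zero).congr fun x => (hz x).symm, ?_⟩
    simp_rw [hz]; rw [tsum_zero]; positivity

/-- [folklore] **MASSES OF `csqK`**: for `nθ < δ_C∕4`, `RowMass∕ColMass (csqK n a) θ (c_C·Zl 4 (δ_C∕4 − nθ))` — the unit-lattice decay of `C`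
(`abs_Csq_le`, `|w−w′|₁ ≤ 4·dist`) read on the sublattice (`|n•w − n•w′|₁ = n|w−w′|₁`). -/
theorem masses_csqK (ha : 0 < a) (hθC : (n : ℝ) * θ < deltaC 4 a / 4) :
    RowMass (csqK n a) θ (cC 4 a * Zl 4 (deltaC 4 a / 4 - n * θ)) ∧ ColMass (csqK n a) θ (cC 4 a * Zl 4 (deltaC 4 a / 4 - n * θ)) := by
  obtain ⟨hinj, hdvd, hdiv⟩ := smul_facts (n := n)
  have hcC := (cC_pos 4 ha).le
  have hZ : 0 ≤ Zl 4 (deltaC 4 a / 4 - n * θ) := (Zl_pos (by linarith)).le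
  have key : RowMass (csqK n a) θ (cC 4 a * Zl 4 (deltaC 4 a / 4 - n * θ)) := by
    intro u
    by_cases hu : ∀ i, (n : ℤ) ∣ u i
    · set w : Site 4 := fun i => u i / (n : ℤ) with hw
      have hueq : u = (n : ℤ) • w := eq_smul_of_dvd hu
      have hzero : ∀ u', ¬ (∀ i, (n : ℤ) ∣ u' i) → rowFn (csqK n a) θ u u' = 0 := fun u' hu' => by
        rw [rowFn_unit]; simp [csqK, hu']
      have hle : ∀ w', rowFn (csqK n a) θ u ((n : ℤ) • w') ≤ cC 4 a * Real.exp (-(deltaC 4 a / 4 - n * θ) * l1 (w - w')) := by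
        intro w'
        rw [rowFn_unit]
        simp only [csqK, hu, Pi.smul_apply, smul_eq_mul, hdiv, dvd_mul_right, forall_const, and_self, if_true]
        have h1 := abs_Csq_le (d := 4) (n - 1) ha w w'
        have h2 : l1 (w - w') ≤ 4 * dist w w' := l1_sub_le_four_mul_dist w w'
        have h3 : l1 (u - (n : ℤ) • w') = (n : ℝ) * l1 (w - w') := by rw [hueq, ← smul_sub, l1_natSmul]
        rw [h3]
        calc |Csq (d := 4) (n - 1) a w w'| * Real.exp (θ * ((n : ℝ) * l1 (w - w')))
            ≤ cC 4 a * Real.exp (-(deltaC 4 a * dist w w')) * Real.exp (θ * ((n : ℝ) * l1 (w - w'))) :=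
              mul_le_mul_of_nonneg_right h1 (Real.exp_pos _).le
          _ = cC 4 a * Real.exp (-(deltaC 4 a * dist w w') + θ * ((n : ℝ) * l1 (w - w'))) := by rw [mul_assoc, ← Real.exp_add]
          _ ≤ cC 4 a * Real.exp (-(deltaC 4 a / 4 - n * θ) * l1 (w - w')) := by
              refine mul_le_mul_of_nonneg_left (Real.exp_le_exp.2 ?_) hcC
              have := deltaC_pos 4 ha
              nlinarith [l1_nonneg (w - w')]
      have hsB : Summable fun w' => cC 4 a * Real.exp (-(deltaC 4 a / 4 - n * θ) * l1 (w - w')) :=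
        (summable_exp_shift (by linarith) w).mul_left _
      have hs : Summable fun w' => rowFn (csqK n a) θ u ((n : ℤ) • w') := hsB.of_nonneg_of_le (fun w' => rowFn_nonneg _ _ _ _) hle
      refine ⟨(summable_sublattice_iff hzero).2 hs, ?_⟩
      rw [tsum_sublattice hzero]
      refine (hs.tsum_le_tsum hle hsB).trans (le_of_eq ?_)
      rw [tsum_mul_left, tsum_exp_shift]
    · have hz : ∀ u', rowFn (csqK n a) θ u u' = 0 := fun u' => by rw [rowFn_unit]; simp [csqK, hu]
      refine ⟨(summable_zero).congr fun u' => (hz u').symm, ?_⟩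
      simp_rw [hz]; rw [tsum_zero]; positivity
  refine ⟨key, ?_⟩
  rw [colMass_iff_rowMass_trK]
  have e : trK (csqK n a) = csqK n a := by
    funext u u' p q
    unfold trK csqK
    by_cases h : (∀ i, (n : ℤ) ∣ u i) ∧ (∀ i, (n : ℤ) ∣ u' i)
    · rw [if_pos h, if_pos ⟨h.2, h.1⟩, Csq_symm (n - 1) ha]
    · rw [if_neg h, if_neg (fun h' => h ⟨h'.2, h'.1⟩)]
  rw [e]; exact key

/-! ## §4 The masses of `Pgt` and `Rgt` -/

/-- [folklore] **THE PROJECTOR's n-FREE MASSES**: from `RowMass∕ColMass (Ggh n a) θ g` and `nθ < δ_C∕4` (`θ ≥ 0`),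
`RowMass∕ColMass (Pgt n a) θ (e^{8nθ}·g²·c_C·Zl 4 (δ_C∕4 − nθ))` — `n⁻⁴·(e^{4nθ}g)·(c_C Zl)·(n⁴e^{4nθ}g)`: the TRUE `n⁰` (the road's pointwise
`RProjector.abs_Pgt_le`, `cPP = O(1)`, gives `n⁴` through `Zl`). -/
theorem masses_Pgt (ha : 0 < a) (hθ : 0 ≤ θ) (hθC : (n : ℝ) * θ < deltaC 4 a / 4) {g : ℝ}
    (hG : RowMass (Ggh n a) θ g ∧ ColMass (Ggh n a) θ g) :
    RowMass (Pgt n a) θ (Real.exp (8 * n * θ) * g ^ 2 * (cC 4 a * Zl 4 (deltaC 4 a / 4 - n * θ))) ∧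
    ColMass (Pgt n a) θ (Real.exp (8 * n * θ) * g ^ 2 * (cC 4 a * Zl 4 (deltaC 4 a / 4 - n * θ))) := by
  have hn : (0 : ℝ) < n := Nat.cast_pos.2 (Nat.pos_of_ne_zero (NeZero.ne n))
  have hR := rowMass_gqK hθ hG.1
  have hC := colMass_gqK hθ hG.2
  obtain ⟨hSr, hSc⟩ := masses_csqK ha hθC
  have h1 : RowMass (comp (comp (gqK n a) (csqK n a)) (trK (gqK n a))) θ
      ((Real.exp (4 * n * θ) * g) * (cC 4 a * Zl 4 (deltaC 4 a / 4 - n * θ)) * ((n : ℝ) ^ 4 * Real.exp (4 * n * θ) * g)) :=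
    rowMass_comp (rowMass_comp hR hSr hθ) (colMass_iff_rowMass_trK.1 hC) hθ
  have key : RowMass (Pgt n a) θ (Real.exp (8 * n * θ) * g ^ 2 * (cC 4 a * Zl 4 (deltaC 4 a / 4 - n * θ))) := by
    rw [Pgt_eq_comp ha]
    have h2 := h1.smul (((n : ℝ) ^ 4)⁻¹)
    refine h2.mono le_rfl (le_of_eq ?_)
    rw [abs_of_pos (by positivity), show (8 : ℝ) * n * θ = 4 * n * θ + 4 * n * θ by ring, Real.exp_add]
    field_simp
  refine ⟨key, ?_⟩
  rw [colMass_iff_rowMass_trK]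
  have e : trK (Pgt n a) = Pgt n a := by
    funext x y u v; unfold trK; exact (Pgt_symm n ha x y u v).symm
  rw [e]; exact key

omit [NeZero n] in
/-- [folklore] `Rgt n a = idK − Pgt n a` as kernels (`RJetProjector.Rgt_apply`). -/
theorem Rgt_eq_idK_sub : Rgt n a = idK - Pgt n a := by
  funext x y u v
  rw [Rgt_apply, Pi.sub_apply, Pi.sub_apply, Pi.sub_apply, Pi.sub_apply, idK_apply]
  simp

omit [NeZero n] in
/-- [folklore] **THE MASSES OF `Rgt = δ − Pgt`**: `RowMass∕ColMass (Rgt n a) θ (1 + π)` from `RowMass∕ColMass (Pgt n a) θ π`. -/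
theorem masses_Rgt {π : ℝ} (hP : RowMass (Pgt n a) θ π ∧ ColMass (Pgt n a) θ π) :
    RowMass (Rgt n a) θ (1 + π) ∧ ColMass (Rgt n a) θ (1 + π) := by
  rw [Rgt_eq_idK_sub]
  exact ⟨masses_idK.1.sub hP.1, masses_idK.2.sub hP.2⟩

end Summit.QuantumFields.BalabanUV.Beta.D1BFx.ProjectorMasses

end
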